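import Mathlib
import Literature.AlgebraicGeometry.Resolution.CobordantGame
import Literature.AlgebraicGeometry.Resolution.CobordantChartCoefficients
import Literature.AlgebraicGeometry.Resolution.FormalCoordinateChange
import Summits.ResolutionOfSingularities.ResolutionOfSingularities.Theorems.WeightedInvariantLocalWeightedDropWildMonicShift
import Summits.ResolutionOfSingularities.ResolutionOfSingularities.Theorems.WeightedInvariantLocalWeightedDropWildPurePowerUnaryExit
import Summits.ResolutionOfSingularities.ResolutionOfSingularities.Theorems.WeightedInvariantLocalWeightedDropUnaryConeForm
import Summits.ResolutionOfSingularities.ResolutionOfSingularities.Theorems.WeightedInvariantLocalWeightedDropWeierstrassForm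

/-!
# `WeightedInvariant.LocalWeightedDrop`, line `hasse-ridge-face-selection`: the WIDE-APEX EXIT for general monic forms — a
# LINEAR re-centring restores a position (every degree `d ≥ 1`)

Crux item stmt-ResolutionOfSingularities-8899 `LocalWeightedDrop` (route `ResolutionOfSingularities/WeightedInvariant`), engine of
the door `HypersurfaceCentreConstruction` stmt-ResolutionOfSingularities-19897.  [OURS · L1 W4.3, chain w43, res-type-083 (extra
seat S3ρ, CHAIN v4.3 D12): §B of `L/res-type-083/S3RHO-DESIGN.md`, exit (E3) of the descent lift for S3ρ
`stub_wildMonicSurfaceReductionWon`.  Not a statement of any manuscript.]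

`exists_linShift_isPos_of_cone_eq` (any dimension, `k` infinite): if the degree-`d` form of the monic form `y^d + Σ_j T_j y^j`
(order `≥ d`) is the function `v ↦ λ (ℓ · v)^d` of one covector, then `λ ℓ_y^d = 1` (the `y^d`-coefficient is `1`:
`coeff_single_last_monicForm`, `initEval_one_piSingle`), and the LINEAR re-centring `y ↦ y - Σ_i (ℓ_i/ℓ_y) x_i` — a linear
substitution whose effect on the degree-`d` form is computed by `AxisNormalize.initEval_subst_linSubst` — has degree-`d` form
`y^d` (`UnaryConeForm.coeff_of_initEval_eq`), so the shifted tuple `shift d T φ` is a POSITION (`ord > d - j`) by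
`WeierstrassForm.coeff_monicForm_of_lt`.  `exists_linShift_isPos_of_wide`: the surface case from two independent
translation-invariance vectors (`WildPurePower.cone_eq_of_wide`).  The generalisation to every `d` of
`WildPurePower.exists_recentre_of_wide` (`d = p^e`, Frobenius).
-/

set_option linter.dupNamespace false -- mandated namespace of this single-conjunct summit

namespace Summit.ResolutionOfSingularities.ResolutionOfSingularities.Theorems

open Literature.AlgebraicGeometry.Resolution
open Literature.AlgebraicGeometry.Resolution.CobordantGame

namespace WildMonic

open MvPowerSeries

variable {k : Type} [Field k] {m : ℕ}

/-! ### The wide-apex exit: a LINEAR re-centring restores a position -/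

/-- The degree-`b` form of `F` evaluated at the basis vector `e_l` is the coefficient of `x_l^b`. -/
theorem initEval_one_piSingle {n : ℕ} (l : Fin n) (b : ℕ) (F : MvPowerSeries (Fin n) k) :
    CobordantChart.initEval (fun _ : Fin n => 1) (Pi.single l 1) b F = coeff (Finsupp.single l b) F := by
  classical
  rw [ApexFreeOrderDrop.initEval_one_eq_sum, Finset.sum_eq_single (Finsupp.single l b)]
  · rw [Finset.prod_eq_single l]
    · rw [Pi.single_eq_same, one_pow, mul_one]
    · intro i _ hi
      rw [Finsupp.single_apply, if_neg (Ne.symm hi), pow_zero]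
    · intro h; exact absurd (Finset.mem_univ l) h
  · intro e he hne
    -- some other slot is charged
    obtain ⟨i, hi, hei⟩ : ∃ i, i ≠ l ∧ e i ≠ 0 := by
      by_contra hcon
      push Not at hcon
      apply hne
      ext i
      by_cases hil : i = l
      · subst hil
        rw [Finsupp.single_eq_same]
        have hdeg : e.degree = b := by
          rw [Finset.mem_finsuppAntidiag] at he
          rw [Finsupp.degree_eq_sum]; exact he.1
        rw [← hdeg, Finsupp.degree_eq_sum, Finset.sum_eq_single i]
        · intro j _ hj; exact hcon j hj
        · intro h; exact absurd (Finset.mem_univ i) h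
      · rw [Finsupp.single_apply, if_neg (Ne.symm hil)]; exact hcon i hil
    rw [Finset.prod_eq_zero (Finset.mem_univ i), mul_zero]
    rw [Pi.single_eq_of_ne hi, zero_pow hei]
  · intro h
    exfalso; apply h
    rw [Finset.mem_finsuppAntidiag, ← Finsupp.degree_eq_sum, Finsupp.degree_single]
    exact ⟨rfl, Finset.subset_univ _⟩

/-- The `y^d`-coefficient of a monic form is `1` (whatever the tuple). -/
theorem coeff_single_last_monicForm {d : ℕ} (T : Fin d → MvPowerSeries (Fin m) k) :
    coeff (Finsupp.single (Fin.last m) d)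
      (X (Fin.last m) ^ d + ∑ j : Fin d, rename (Fin.succAboveEmb (Fin.last m)) (T j) * X (Fin.last m) ^ (j : ℕ)) = 1 := by
  classical
  have h := WeierstrassForm.coeff_monicForm T 0 d
  rw [Finsupp.embDomain_zero, zero_add] at h
  rw [h, if_pos rfl, coeff_zero_eq_constantCoeff, map_one, Finset.sum_eq_zero, add_zero]
  intro j _
  rw [if_neg (ne_of_lt j.2)]

/-- THE WIDE-APEX EXIT IN ANY DIMENSION (`k` infinite): if the degree-`d` form of the monic form of a tuple `T` (order `≥ d`,
`d ≥ 1`) is a function `λ · (ℓ · v)^d` of ONE covector, then `ℓ_y ≠ 0` (the `y^d`-coefficient is `1`) and the LINEAR re-centring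
`y ↦ y - Σ_i (ℓ_i/ℓ_y) x_i` carries it to a POSITION: `ord (shift d T φ)_j > d - j` for `φ = -Σ_i (ℓ_i/ℓ_y) x_i`. -/
theorem exists_linShift_isPos_of_cone_eq [Infinite k] {d : ℕ} (hd : 0 < d) (T : Fin d → MvPowerSeries (Fin m) k)
    (hSo : (d : ℕ∞) ≤ (X (Fin.last m) ^ d +
      ∑ j : Fin d, rename (Fin.succAboveEmb (Fin.last m)) (T j) * X (Fin.last m) ^ (j : ℕ)).order)
    (la : k) (ℓ : Fin (m + 1) → k)
    (hcone : ∀ v : Fin (m + 1) → k, CobordantChart.initEval (fun _ : Fin (m + 1) => 1) v d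
      (X (Fin.last m) ^ d + ∑ j : Fin d, rename (Fin.succAboveEmb (Fin.last m)) (T j) * X (Fin.last m) ^ (j : ℕ)) =
      la * dotProduct ℓ v ^ d) :
    ∃ μ : Fin m → k, ∀ j : Fin d, ((d - (j : ℕ) : ℕ) : ℕ∞) <
      (shift d T (-(∑ i : Fin m, C (μ i) * X i)) j).order := by
  classical
  set S : MvPowerSeries (Fin (m + 1)) k := X (Fin.last m) ^ d +
    ∑ j : Fin d, rename (Fin.succAboveEmb (Fin.last m)) (T j) * X (Fin.last m) ^ (j : ℕ) with hS
  -- `λ ℓ_y^d = 1`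
  have hla : la * ℓ (Fin.last m) ^ d = 1 := by
    have h := hcone (Pi.single (Fin.last m) 1)
    rw [initEval_one_piSingle, hS, coeff_single_last_monicForm, dotProduct_single, mul_one] at h
    exact h.symm
  have hℓy : ℓ (Fin.last m) ≠ 0 := by
    intro h0
    rw [h0, zero_pow hd.ne', mul_zero] at hla
    exact zero_ne_one hla
  set μ : Fin m → k := fun i => ℓ (Fin.castSucc i) / ℓ (Fin.last m) with hμ
  set φ : MvPowerSeries (Fin m) k := -(∑ i : Fin m, C (μ i) * X i) with hφ
  have hφ0 : constantCoeff φ = 0 := by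
    rw [hφ, map_neg, map_sum, Finset.sum_eq_zero, neg_zero]
    intro i _
    rw [map_mul, constantCoeff_X, mul_zero]
  refine ⟨μ, ?_⟩
  -- the shear as a linear substitution
  set M : Matrix (Fin (m + 1)) (Fin (m + 1)) k := Matrix.of fun l j =>
    if l = Fin.last m then (if j = Fin.last m then (1 : k) else -(ℓ j / ℓ (Fin.last m))) else (if j = l then 1 else 0)
    with hM
  have hemb : ∀ i : Fin m, (Fin.succAboveEmb (Fin.last m)) i = Fin.castSucc i := fun i => by
    rw [Fin.coe_succAboveEmb, Fin.succAbove_last]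
  have hMlast : M (Fin.last m) (Fin.last m) = 1 := by rw [hM, Matrix.of_apply, if_pos rfl, if_pos rfl]
  have hMcs : ∀ i : Fin m, M (Fin.last m) (Fin.castSucc i) = -(ℓ (Fin.castSucc i) / ℓ (Fin.last m)) := fun i => by
    rw [hM, Matrix.of_apply, if_pos rfl, if_neg (Fin.castSucc_lt_last i).ne]
  have hMrow : ∀ l, l ≠ Fin.last m → ∀ j, M l j = if j = l then 1 else 0 := fun l hl j => by
    rw [hM, Matrix.of_apply, if_neg hl]
  have hfun : (fun l : Fin (m + 1) => if l = Fin.last m then X (Fin.last m) + rename (Fin.succAboveEmb (Fin.last m)) φ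
      else X l) = FormalCoordChange.linSubst M := by
    funext l
    simp only [FormalCoordChange.linSubst]
    by_cases hl : l = Fin.last m
    · subst hl
      rw [if_pos rfl, Fin.sum_univ_castSucc]
      simp only [hMlast, hMcs, one_smul]
      rw [add_comm (X (Fin.last m) : MvPowerSeries (Fin (m + 1)) k), hφ, map_neg, map_sum, ← Finset.sum_neg_distrib]
      congr 1
      refine Finset.sum_congr rfl fun i _ => ?_
      rw [map_mul, rename_C, rename_X, hemb, hμ, neg_smul, smul_eq_C_mul]
    · rw [if_neg hl]
      simp only [hMrow l hl]
      rw [Finset.sum_eq_single l]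
      · rw [if_pos rfl, one_smul]
      · intro j _ hj; rw [if_neg hj, zero_smul]
      · intro h; exact absurd (Finset.mem_univ l) h
  -- the re-centred form and its degree-`d` part
  set S' : MvPowerSeries (Fin (m + 1)) k := subst (FormalCoordChange.linSubst M) S with hS'
  have hS'eq : S' = X (Fin.last m) ^ d +
      ∑ j : Fin d, rename (Fin.succAboveEmb (Fin.last m)) (shift d T φ j) * X (Fin.last m) ^ (j : ℕ) := by
    rw [hS', ← hfun, hS]
    exact subst_shear_monicForm φ hφ0 T
  have hmulVec : ∀ v : Fin (m + 1) → k, dotProduct ℓ (M.mulVec v) = ℓ (Fin.last m) * v (Fin.last m) := by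
    intro v
    have hvlast : M.mulVec v (Fin.last m) =
        v (Fin.last m) - ∑ i : Fin m, ℓ (Fin.castSucc i) / ℓ (Fin.last m) * v (Fin.castSucc i) := by
      simp only [Matrix.mulVec, dotProduct]
      rw [Fin.sum_univ_castSucc]
      simp only [hMlast, hMcs, one_mul, neg_mul]
      rw [Finset.sum_neg_distrib]
      ring
    have hvcs : ∀ i : Fin m, M.mulVec v (Fin.castSucc i) = v (Fin.castSucc i) := fun i => by
      simp only [Matrix.mulVec, dotProduct]
      simp only [hMrow _ (Fin.castSucc_lt_last i).ne]
      rw [Finset.sum_eq_single (Fin.castSucc i)]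
      · rw [if_pos rfl, one_mul]
      · intro j _ hj; rw [if_neg hj, zero_mul]
      · intro h; exact absurd (Finset.mem_univ _) h
    rw [dotProduct, Fin.sum_univ_castSucc]
    simp only [hvlast, hvcs]
    rw [mul_sub, Finset.mul_sum]
    have hcancel : ∀ i : Fin m, ℓ (Fin.last m) * (ℓ (Fin.castSucc i) / ℓ (Fin.last m) * v (Fin.castSucc i)) =
        ℓ (Fin.castSucc i) * v (Fin.castSucc i) := fun i => by
      rw [← mul_assoc, mul_div_cancel₀ _ hℓy]
    simp only [hcancel]
    ring
  have hin : ∀ v : Fin (m + 1) → k,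
      CobordantChart.initEval (fun _ : Fin (m + 1) => 1) v d S' = 1 * v (Fin.last m) ^ d := by
    intro v
    rw [hS', AxisNormalize.initEval_subst_linSubst (Fin.last m), hcone, hmulVec, mul_pow, ← mul_assoc, hla]
  have hdiag : ∀ E : Fin (m + 1) →₀ ℕ, E.degree = d →
      coeff E S' = if E = Finsupp.single (Fin.last m) d then 1 else 0 := fun E hE =>
    UnaryConeForm.coeff_of_initEval_eq S' d 1 hin hE
  have hS'o : (d : ℕ∞) ≤ S'.order := by
    rw [hS']
    exact ConeDichotomy.le_order_subst_of_le _ (ConeDichotomy.constantCoeff_linSubst M) S _ (by rw [hS] at hSo; exact hSo)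
  -- read off the position condition
  intro j
  refine lt_of_lt_of_le (by exact_mod_cast Nat.lt_succ_self _) (nat_le_order fun β hβ => ?_)
  rw [← WeierstrassForm.coeff_monicForm_of_lt (shift d T φ) β j, ← hS'eq]
  have hdeg := TschirnhausForm.degree_emb_add_single β (j : ℕ)
  by_cases hlt : β.degree + (j : ℕ) < d
  · exact coeff_of_lt_order (lt_of_lt_of_le (by rw [hdeg]; exact_mod_cast hlt) hS'o)
  · have heq : β.degree + (j : ℕ) = d := by
      have := j.2
      have hβ' : β.degree < d - (j : ℕ) + 1 := by exact_mod_cast hβ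
      omega
    rw [hdiag _ (by rw [hdeg, heq]), if_neg]
    intro h
    have h' := DFunLike.congr_fun h (Fin.last m)
    rw [TschirnhausForm.emb_add_single_last, Finsupp.single_eq_same] at h'
    exact absurd h' (ne_of_lt j.2)


/-- A monic form has order `≤ d` (its `y^d`-coefficient is `1`). -/
theorem order_monicForm_le {d : ℕ} (T : Fin d → MvPowerSeries (Fin m) k) :
    (X (Fin.last m) ^ d + ∑ j : Fin d, rename (Fin.succAboveEmb (Fin.last m)) (T j) * X (Fin.last m) ^ (j : ℕ)).order ≤
      (d : ℕ∞) := by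
  have h := order_le (f := X (Fin.last m) ^ d +
      ∑ j : Fin d, rename (Fin.succAboveEmb (Fin.last m)) (T j) * X (Fin.last m) ^ (j : ℕ))
    (d := Finsupp.single (Fin.last m) d) (by rw [coeff_single_last_monicForm]; exact one_ne_zero)
  rwa [Finsupp.degree_single] at h

/-- THE WIDE-APEX EXIT FOR SURFACES: over an algebraically closed field, a monic successor `y^d + Σ T_j y^j` (`d ≥ 1`, order
`≥ d`) whose degree-`d` form has two independent translation-invariance vectors re-centres LINEARLY to a position. -/
theorem exists_linShift_isPos_of_wide (k : Type) [Field k] [IsAlgClosed k] {d : ℕ} (hd : 0 < d)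
    (T : Fin d → MvPowerSeries (Fin 2) k)
    (hSo : (d : ℕ∞) ≤ ((X (Fin.last 2) : MvPowerSeries (Fin (2 + 1)) k) ^ d +
      ∑ j : Fin d, rename (Fin.succAboveEmb (Fin.last 2)) (T j) * X (Fin.last 2) ^ (j : ℕ)).order)
    (c₁ c₂ : Fin 3 → k) (hind : ∀ α β : k, α • c₁ + β • c₂ = 0 → α = 0 ∧ β = 0)
    (h₁ : ∀ v : Fin 3 → k, CobordantChart.initEval (fun _ : Fin 3 => 1) (v + c₁) d
      ((X (Fin.last 2) : MvPowerSeries (Fin (2 + 1)) k) ^ d +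
        ∑ j : Fin d, rename (Fin.succAboveEmb (Fin.last 2)) (T j) * X (Fin.last 2) ^ (j : ℕ)) =
      CobordantChart.initEval (fun _ : Fin 3 => 1) v d
      ((X (Fin.last 2) : MvPowerSeries (Fin (2 + 1)) k) ^ d +
        ∑ j : Fin d, rename (Fin.succAboveEmb (Fin.last 2)) (T j) * X (Fin.last 2) ^ (j : ℕ)))
    (h₂ : ∀ v : Fin 3 → k, CobordantChart.initEval (fun _ : Fin 3 => 1) (v + c₂) d
      ((X (Fin.last 2) : MvPowerSeries (Fin (2 + 1)) k) ^ d +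
        ∑ j : Fin d, rename (Fin.succAboveEmb (Fin.last 2)) (T j) * X (Fin.last 2) ^ (j : ℕ)) =
      CobordantChart.initEval (fun _ : Fin 3 => 1) v d
      ((X (Fin.last 2) : MvPowerSeries (Fin (2 + 1)) k) ^ d +
        ∑ j : Fin d, rename (Fin.succAboveEmb (Fin.last 2)) (T j) * X (Fin.last 2) ^ (j : ℕ))) :
    ∃ μ : Fin 2 → k, ∀ j : Fin d, ((d - (j : ℕ) : ℕ) : ℕ∞) <
      (shift d T (-(∑ i : Fin 2, C (μ i) * X i)) j).order := by
  haveI : Infinite k := IsAlgClosed.instInfinite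
  obtain ⟨la, ℓ, -, hcone⟩ := WildPurePower.cone_eq_of_wide _ d c₁ c₂ hind h₁ h₂
  exact exists_linShift_isPos_of_cone_eq hd T hSo la ℓ hcone

end WildMonic

end Summit.ResolutionOfSingularities.ResolutionOfSingularities.Theorems
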